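import Summits.SmoothPoincare4.SmoothPoincare4.Theses.EntropyLadder
import Literature.Topology.FourManifolds.ConnectedSum
import HarnessLib
import HarnessLib.Audit

/-!
# Birth skeleton (BC3) for crux `EntropyLadder.PresentationSpheresStandard` (item stmt-SmoothPoincare4-3717)

Line `birth` — the ONE-STABILISATION SPLIT of "presentation spheres are standard" (T).

T (the crux, verbatim the route decl
`Summit.SmoothPoincare4.SmoothPoincare4.Theses.EntropyLadder.PresentationSpheresStandard`, shared by the routes
EntropyLadder (rank 2), ConvexityLadder (rank 3) and RicciTranscript (rank 3)): every smooth homotopy 4-sphere `M`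
(bare binders of `SmoothPoincare4`: Hausdorff, second countable, `C^∞` atlas on `𝓡 4`, `e : M ≃ₕ S⁴`) which bounds a
compact contractible smooth 5-manifold `W` carrying a Morse function adapted to `∂W` all of whose critical points
have index `≤ 2` (`Bounds₂ M` below — a PRESENTATION SPHERE `∂H⁵(P, ε)`, `P` a balanced presentation of the
trivial group) is diffeomorphic to `S⁴`.  Equivalently (crux docstring): every compact contractible 5-dimensional
2-handlebody is `B⁵` — the 5-dimensional Andrews–Curtis problem (Kirby 1997, 5.2; AndrewsCurtis1965; Gompf1991Killing).

The line factors T through ONE `S² × S²` STABILISATION, typed entirely over tree vocabulary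
(`Literature.Topology.FourManifolds.IsConnectedSum`, the Morse vocabulary of the crux itself):

* STUB 1 `stub_oneStabDissolve` — PRESENTATION SPHERES DISSOLVE AFTER ONE `S²×S²`: every presentation sphere `M`
  (`e : M ≃ₕ S⁴`, `Bounds₂ M`) has SOME connected sum `M # (S²×S²)` (relational `IsConnectedSum`, sum on `𝓡 4`,
  `S²×S²` on `(𝓡 2).prod (𝓡 2)`) diffeomorphic to `S²×S²`.  Grounding (the 5-dimensional picture of Kirby1989,
  Ch. I, pp. 18–19 = PDF pp. 15–16, "up the dimension by 1 … attaching circles are unknotted and unlinked in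
  `S⁴ = ∂B⁵`"; AndrewsCurtis1965; FreedmanGompfMorrisonWalker2010 Fact 2): write `W = H⁵(P, ε)` (tree named fact
  `IsPresentationHandlebodyFive.exists_of_contractibleSpace`, Kosinski VII) with `r` 1-handles and `r` 2-handles and
  attach 2-handles `h'ᵢ` along the `r` generator meridians `xᵢ ⊂ ∂W`; each `h'ᵢ` cancels the `i`-th 1-handle, so
  `W ∪ ⋃ h'ᵢ ≅ B⁵ ∪ r (2-handles along circles in S⁴, unknotted and unlinked) ≅ ♮ʳ(S² × B³)` for the spin choice of
  the framings of the `h'ᵢ`, while the `xᵢ` are null-homotopic, hence (circles in a simply connected 4-manifold) an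
  unlink in a ball of `∂W`, so `W ∪ ⋃ h'ᵢ ≅ W ♮ r(S² × B³)`; taking boundaries, `M # r(S²×S²) ≅ #ʳ(S²×S²)` with
  `r` = the number of generators of `P`, UNCONDITIONALLY (for a general homotopy 4-sphere only SOME `k` is known,
  Wall 1964 + `Θ₄ = 0`).  `r ≤ 2` gives ONE stabilisation: surgery on the single meridian `x` leaves the 5-manifold
  `S¹×B⁴ ∪ h²(yᵃ) ∪ h²(yᵇ)` with `gcd(a, b) = 1` (`a`, `b` = exponent sums of `y` in the two relators), which
  Euclid's algorithm by 2-handle slides turns into `S¹×B⁴ ∪ h²(y) ∪ h²(1) ≅ S² × B³` (cf. the crux evidence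
  `idea-peelable-presentation-spheres.md`, THEOREM A, same statement).  From `r = 3` generators on no argument is
  known to this seat (the residual 5-manifold is the thickening of a deficiency-one presentation
  `⟨x₂, x₃ ∣ w̄₁, w̄₂, w̄₃⟩` of the trivial group — Andrews–Curtis with ONE memory slot, in Kirby's words
  "remembering" one relation).  It is NOT the crux: it concludes a stabilised diffeomorphism, not `M ≅ S⁴`, and it is
  implied by SPC4 only through the existence of connected sums (`S⁴ # Q ≅ Q`).
* STUB 2 `stub_oneStabCancel` — ONE-SUMMAND CANCELLATION FOR PRESENTATION SPHERES: a presentation sphere `M`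
  (`e`, `Bounds₂ M`) admitting such a stabilisation `M # (S²×S²) ≅ S²×S²` is diffeomorphic to `S⁴`.  This is the
  Stabilisation route's crux `StabCancellation` (stmt-SmoothPoincare4-0385, all homotopy 4-spheres) RESTRICTED to
  presentation spheres, where the stabilisation comes with a 5-dimensional filling: `M # (S²×S²) = ∂(W ∪ h')` and a
  diffeomorphism `W ♮ (S²×B³) ≅ S²×B³` turns T into the 5-dimensional cancellation "`(S²×B³) ∪_A h³ ≅ B⁵` for the
  image `A ⊂ S²×S²` of the factor sphere, which has the geometric dual `Φ({pt} × ∂B³)`" — the light-bulb setting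
  (Gabai2020 Thm 1.2/10.1, with the dual NOT known to be standard: exactly the open point recorded on 0385).  OPEN
  (SPC4-shielded shape `∀ M ≃ₕ S⁴, P M → M ≅ S⁴`, BARRIERS §D.1).  It is NOT the crux: its extra hypothesis (the
  one-stabilisation) is supplied only by STUB 1, itself open.

COMPOSITION (kernel-checked, no `sorry` outside the two stubs): `presentationSpheresStandard_of_stubs :
<stub₁-sig> → <stub₂-sig> → <the crux statement>` (2 tactic lines: take `M, e, hB`; STUB 1 gives the
stabilisation; STUB 2 at `(M, e, hB, it)` is the goal) and THE skeleton theorem `PresentationSpheresStandard_of :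
EntropyLadder.PresentationSpheresStandard := presentationSpheresStandard_of_stubs stub_oneStabDissolve
stub_oneStabCancel` — the crux BY NAME, closed modulo the two registered stubs (D-0027 §3.3 shape).  It is
deliberately the ONLY theorem of the file whose conclusion is the crux constant, so `#h21_check_skeleton` audits
exactly it; the arrow form `<stub₁-sig> → <stub₂-sig> → PresentationSpheresStandard` is certified by the closing
`example`.

DISPROOF USED: no `Disproof.lean` exists for this crux (`ledger crux ls stmt-SmoothPoincare4-3717`: no workfiles,
2026-08-17); negatives index for SmoothPoincare4: 0 refuted statement items (BARRIERS.lean §0).  Refuter / grounder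
stamps on the item (2026-08-15): rc0, hypothesis `Bounds₂` NON-VACUOUS (`W = 𝔻⁵`, `f = ‖x‖²`, `M = S⁴` is a genuine
witness), conclusion is the SPC4 conclusion so `SmoothPoincare4 → T` compiles — T is unrefutable short of an exotic
presentation sphere.  Both stubs keep `e` AND `Bounds₂ M` (no empty-carrier / `S⁴ ⊔ S⁴` junk: `e` forces `M` nonempty,
connected, closed), and STUB 1's conclusion is an `∃` over connected sums, not a universally junk-true clause.

BARRIERS: `Literature.Barriers.SmoothPoincare4.OneStabilisationBarrier` (Kang 2022: one `S²×S²` does not undo every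
CORK, i.e. compact contractible 4-manifolds WITH boundary) — STUB 1 is about CLOSED presentation spheres (`b₂ = 0`),
Kang's open Question 1 territory: conceded, not evaded; the bet is the 5-dimensional filling `W ♮ r(S²×B³) ≅ ♮ʳ(S²×B³)`,
which corks do not have.  `StableBarrierFour` / `HCobordismInvariantBarrierFour` — void here (no stable or
h-cobordism INVARIANT is computed; one explicit summand is cancelled geometrically).  `StrictPropertyTwoRBarrier`
(A16, threatens EntropyLadder's 5-dim AC handlebodies) — not touched: neither stub asserts a handle-slide /
Andrews–Curtis statement about presentations; AC-triviality is sufficient for T (tree named fact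
`IsPresentationHandlebodyFive.nonempty_diffeomorph_closedBall_of_isStablyAndrewsCurtisEquivalent`) but never claimed
necessary.  `HCobordismBarrierFour` (A5) — the 2/3-handle pair hidden in STUB 2 is ONE pair with a 5-dimensional
filling, not the general h-cobordism principle (which is false).

ALTERNATIVE LINE NOT FILED (recorded for the lead): the `H⁵(P, ε)` TRANSFER — T ⇐ READ ∧ BALL ∧ ∂-transport with
READ = tree named fact `IsPresentationHandlebodyFive.exists_of_contractibleSpace` (every `Bounds₂`-filling is an
`H⁵(P, ε)`, `P ⊢ 1`; known, Kosinski VII) and BALL = "every `H⁵(P, ε)` of the trivial group is `≅ 𝔻⁵`" (open) —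
rejected as the birth skeleton because BALL is T in `H⁵` clothes (the crux docstring lists it as an equivalent
form); it is the natural SECOND line once `PresentationHandlebodyFive` API (AC moves `conj`/`inv`/`basisChange`
proved; `mul` = 2-handle slide) is used to attack STUB 1 by induction on `r`.
-/

noncomputable section

open scoped Manifold ContDiff Topology
open Literature.Topology.FourManifolds

namespace Summit.SmoothPoincare4.SmoothPoincare4.Cruxes.PresentationSpheresStandard.Birth

set_option linter.dupNamespace false
set_option linter.unusedVariables false

/-- Local notation: the round 2-sphere `S² ⊂ ℝ³` (Mathlib manifold structure, model `𝓡 2`). -/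
local notation "S²" => (Metric.sphere (0 : EuclideanSpace ℝ (Fin 3)) 1)

/-- Local notation: the round 4-sphere `S⁴ ⊂ ℝ⁵` (model `𝓡 4`). -/
local notation "S⁴" => (Metric.sphere (0 : EuclideanSpace ℝ (Fin 5)) 1)

/-! ## The two registered stubs (`sorry` lives ONLY here; signatures spelled out over tree declarations) -/

/-- STUB 1 (registered) — PRESENTATION SPHERES DISSOLVE AFTER ONE `S²×S²`: for every smooth homotopy 4-sphere `M`
(bare binders of the crux: Hausdorff, second countable, `C^∞` on `𝓡 4`, `e : M ≃ₕ S⁴`) bounding a compact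
contractible smooth 5-manifold `W` with a `∂`-adapted Morse function of index `≤ 2` (the crux hypothesis, verbatim),
some connected sum `M # (S²×S²)` (relational `IsConnectedSum`, sum on `𝓡 4`, `S²×S²` on `(𝓡 2).prod (𝓡 2)`) is
diffeomorphic to `S²×S²`.  Size: open from 3 generators on, as far as this seat knows (L–XL); `M # r(S²×S²) ≅ #ʳ(S²×S²)` (`r` =
number of generators) is the classical 5-dimensional meridian-surgery computation (Kirby1989 Ch. I pp. 18–19;
AndrewsCurtis1965) and `r ≤ 2` reduces to Euclid's algorithm on `⟨y ∣ yᵃ, yᵇ⟩`, `gcd(a, b) = 1`. -/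
theorem stub_oneStabDissolve :
    ∀ (M : Type) [TopologicalSpace M] [T2Space M] [SecondCountableTopology M]
      [ChartedSpace (EuclideanSpace ℝ (Fin 4)) M] [IsManifold (𝓡 4) ∞ M],
      ContinuousMap.HomotopyEquiv M S⁴ →
      (∃ (W : Type) (_ : TopologicalSpace W) (_ : T2Space W) (_ : SecondCountableTopology W)
          (_ : ChartedSpace (EuclideanHalfSpace (4 + 1)) W) (_ : IsManifold (𝓡∂ (4 + 1)) ∞ W)
          (_ : CompactSpace W),
          ContractibleSpace W ∧
            (∃ f : W → ℝ, IsMorseAdapted (𝓡∂ (4 + 1)) f ∧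
              ∀ z, IsMCriticalPt (𝓡∂ (4 + 1)) f z → morseIndex (𝓡∂ (4 + 1)) f z ≤ 2) ∧
            ∃ φ : M → W, Manifold.IsSmoothEmbedding (𝓡 4) (𝓡∂ (4 + 1)) ∞ φ ∧
              Set.range φ = (𝓡∂ (4 + 1)).boundary W) →
      ∃ (P : Type) (_ : TopologicalSpace P) (_ : ChartedSpace (EuclideanSpace ℝ (Fin 4)) P)
          (_ : IsManifold (𝓡 4) ∞ P),
          IsConnectedSum (𝓡 4) (𝓡 4) ((𝓡 2).prod (𝓡 2)) M (S² × S²) P ∧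
            Nonempty (P ≃ₘ⟮𝓡 4, (𝓡 2).prod (𝓡 2)⟯ (S² × S²)) := by
  sorry

/-- STUB 2 (registered) — ONE-SUMMAND CANCELLATION FOR PRESENTATION SPHERES: a smooth homotopy 4-sphere `M`
(`e : M ≃ₕ S⁴`) bounding a compact contractible smooth 5-manifold with a `∂`-adapted Morse function of index `≤ 2`
(the crux hypothesis, verbatim) which moreover admits a connected sum `M # (S²×S²)` diffeomorphic to `S²×S²` is
diffeomorphic to `S⁴` — the conclusion of the crux.  Size: open problem (XL; = the Stabilisation route's crux
`StabCancellation`, stmt-SmoothPoincare4-0385, restricted to presentation spheres, where `W ♮ (S²×B³) ≅ S²×B³`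
makes it a 5-dimensional 3-handle cancellation with a geometric dual — Gabai2020 light-bulb setting). -/
theorem stub_oneStabCancel :
    ∀ (M : Type) [TopologicalSpace M] [T2Space M] [SecondCountableTopology M]
      [ChartedSpace (EuclideanSpace ℝ (Fin 4)) M] [IsManifold (𝓡 4) ∞ M],
      ContinuousMap.HomotopyEquiv M S⁴ →
      (∃ (W : Type) (_ : TopologicalSpace W) (_ : T2Space W) (_ : SecondCountableTopology W)
          (_ : ChartedSpace (EuclideanHalfSpace (4 + 1)) W) (_ : IsManifold (𝓡∂ (4 + 1)) ∞ W)
          (_ : CompactSpace W),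
          ContractibleSpace W ∧
            (∃ f : W → ℝ, IsMorseAdapted (𝓡∂ (4 + 1)) f ∧
              ∀ z, IsMCriticalPt (𝓡∂ (4 + 1)) f z → morseIndex (𝓡∂ (4 + 1)) f z ≤ 2) ∧
            ∃ φ : M → W, Manifold.IsSmoothEmbedding (𝓡 4) (𝓡∂ (4 + 1)) ∞ φ ∧
              Set.range φ = (𝓡∂ (4 + 1)).boundary W) →
      (∃ (P : Type) (_ : TopologicalSpace P) (_ : ChartedSpace (EuclideanSpace ℝ (Fin 4)) P)
          (_ : IsManifold (𝓡 4) ∞ P),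
          IsConnectedSum (𝓡 4) (𝓡 4) ((𝓡 2).prod (𝓡 2)) M (S² × S²) P ∧
            Nonempty (P ≃ₘ⟮𝓡 4, (𝓡 2).prod (𝓡 2)⟯ (S² × S²))) →
      Nonempty (M ≃ₘ⟮𝓡 4, 𝓡 4⟯ S⁴) := by
  sorry

/-! ## Composition: stubs ⟹ crux (no `sorry` below this line) -/

/-- **The one-stabilisation split of T, arrow form**: if every presentation sphere dissolves after one `S²×S²`
(STUB 1) and every presentation sphere that so dissolves is `S⁴` (STUB 2), then every presentation sphere is `S⁴` —
the statement of the crux `EntropyLadder.PresentationSpheresStandard`, unfolded (so that this arrow theorem is not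
itself a by-name candidate for the skeleton audit; the by-name theorem is `PresentationSpheresStandard_of` below). -/
theorem presentationSpheresStandard_of_stubs
    (h₁ : ∀ (M : Type) [TopologicalSpace M] [T2Space M] [SecondCountableTopology M]
      [ChartedSpace (EuclideanSpace ℝ (Fin 4)) M] [IsManifold (𝓡 4) ∞ M],
      ContinuousMap.HomotopyEquiv M S⁴ →
      (∃ (W : Type) (_ : TopologicalSpace W) (_ : T2Space W) (_ : SecondCountableTopology W)
          (_ : ChartedSpace (EuclideanHalfSpace (4 + 1)) W) (_ : IsManifold (𝓡∂ (4 + 1)) ∞ W)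
          (_ : CompactSpace W),
          ContractibleSpace W ∧
            (∃ f : W → ℝ, IsMorseAdapted (𝓡∂ (4 + 1)) f ∧
              ∀ z, IsMCriticalPt (𝓡∂ (4 + 1)) f z → morseIndex (𝓡∂ (4 + 1)) f z ≤ 2) ∧
            ∃ φ : M → W, Manifold.IsSmoothEmbedding (𝓡 4) (𝓡∂ (4 + 1)) ∞ φ ∧
              Set.range φ = (𝓡∂ (4 + 1)).boundary W) →
      ∃ (P : Type) (_ : TopologicalSpace P) (_ : ChartedSpace (EuclideanSpace ℝ (Fin 4)) P)
          (_ : IsManifold (𝓡 4) ∞ P),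
          IsConnectedSum (𝓡 4) (𝓡 4) ((𝓡 2).prod (𝓡 2)) M (S² × S²) P ∧
            Nonempty (P ≃ₘ⟮𝓡 4, (𝓡 2).prod (𝓡 2)⟯ (S² × S²)))
    (h₂ : ∀ (M : Type) [TopologicalSpace M] [T2Space M] [SecondCountableTopology M]
      [ChartedSpace (EuclideanSpace ℝ (Fin 4)) M] [IsManifold (𝓡 4) ∞ M],
      ContinuousMap.HomotopyEquiv M S⁴ →
      (∃ (W : Type) (_ : TopologicalSpace W) (_ : T2Space W) (_ : SecondCountableTopology W)
          (_ : ChartedSpace (EuclideanHalfSpace (4 + 1)) W) (_ : IsManifold (𝓡∂ (4 + 1)) ∞ W)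
          (_ : CompactSpace W),
          ContractibleSpace W ∧
            (∃ f : W → ℝ, IsMorseAdapted (𝓡∂ (4 + 1)) f ∧
              ∀ z, IsMCriticalPt (𝓡∂ (4 + 1)) f z → morseIndex (𝓡∂ (4 + 1)) f z ≤ 2) ∧
            ∃ φ : M → W, Manifold.IsSmoothEmbedding (𝓡 4) (𝓡∂ (4 + 1)) ∞ φ ∧
              Set.range φ = (𝓡∂ (4 + 1)).boundary W) →
      (∃ (P : Type) (_ : TopologicalSpace P) (_ : ChartedSpace (EuclideanSpace ℝ (Fin 4)) P)
          (_ : IsManifold (𝓡 4) ∞ P),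
          IsConnectedSum (𝓡 4) (𝓡 4) ((𝓡 2).prod (𝓡 2)) M (S² × S²) P ∧
            Nonempty (P ≃ₘ⟮𝓡 4, (𝓡 2).prod (𝓡 2)⟯ (S² × S²))) →
      Nonempty (M ≃ₘ⟮𝓡 4, 𝓡 4⟯ S⁴)) :
    ∀ (M : Type) [TopologicalSpace M] [T2Space M] [SecondCountableTopology M]
      [ChartedSpace (EuclideanSpace ℝ (Fin 4)) M] [IsManifold (𝓡 4) ∞ M],
      ContinuousMap.HomotopyEquiv M S⁴ →
      (∃ (W : Type) (_ : TopologicalSpace W) (_ : T2Space W) (_ : SecondCountableTopology W)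
          (_ : ChartedSpace (EuclideanHalfSpace (4 + 1)) W) (_ : IsManifold (𝓡∂ (4 + 1)) ∞ W)
          (_ : CompactSpace W),
          ContractibleSpace W ∧
            (∃ f : W → ℝ, IsMorseAdapted (𝓡∂ (4 + 1)) f ∧
              ∀ z, IsMCriticalPt (𝓡∂ (4 + 1)) f z → morseIndex (𝓡∂ (4 + 1)) f z ≤ 2) ∧
            ∃ φ : M → W, Manifold.IsSmoothEmbedding (𝓡 4) (𝓡∂ (4 + 1)) ∞ φ ∧
              Set.range φ = (𝓡∂ (4 + 1)).boundary W) →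
      Nonempty (M ≃ₘ⟮𝓡 4, 𝓡 4⟯ S⁴) := by
  intro M _ _ _ _ _ e hB
  exact h₂ M e hB (h₁ M e hB)

/-- **`PresentationSpheresStandard_of` — THE SKELETON**: the crux `EntropyLadder.PresentationSpheresStandard` BY
NAME, closed modulo the two registered stubs (D-0027 §3.3: `<Crux>_proof := crux_of stub₁_holds stub₂_holds`).
Becomes the crux proof when both stubs are discharged. -/
theorem PresentationSpheresStandard_of :
    Summit.SmoothPoincare4.SmoothPoincare4.Theses.EntropyLadder.PresentationSpheresStandard :=
  presentationSpheresStandard_of_stubs stub_oneStabDissolve stub_oneStabCancel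

/-- BC3 letter: `<stub₁-sig> → <stub₂-sig> → PresentationSpheresStandard` with the crux BY NAME (an `example`, so
that `PresentationSpheresStandard_of` stays the only by-name candidate the skeleton audit sees). -/
example :
    (∀ (M : Type) [TopologicalSpace M] [T2Space M] [SecondCountableTopology M]
      [ChartedSpace (EuclideanSpace ℝ (Fin 4)) M] [IsManifold (𝓡 4) ∞ M],
      ContinuousMap.HomotopyEquiv M S⁴ →
      (∃ (W : Type) (_ : TopologicalSpace W) (_ : T2Space W) (_ : SecondCountableTopology W)
          (_ : ChartedSpace (EuclideanHalfSpace (4 + 1)) W) (_ : IsManifold (𝓡∂ (4 + 1)) ∞ W)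
          (_ : CompactSpace W),
          ContractibleSpace W ∧
            (∃ f : W → ℝ, IsMorseAdapted (𝓡∂ (4 + 1)) f ∧
              ∀ z, IsMCriticalPt (𝓡∂ (4 + 1)) f z → morseIndex (𝓡∂ (4 + 1)) f z ≤ 2) ∧
            ∃ φ : M → W, Manifold.IsSmoothEmbedding (𝓡 4) (𝓡∂ (4 + 1)) ∞ φ ∧
              Set.range φ = (𝓡∂ (4 + 1)).boundary W) →
      ∃ (P : Type) (_ : TopologicalSpace P) (_ : ChartedSpace (EuclideanSpace ℝ (Fin 4)) P)
          (_ : IsManifold (𝓡 4) ∞ P),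
          IsConnectedSum (𝓡 4) (𝓡 4) ((𝓡 2).prod (𝓡 2)) M (S² × S²) P ∧
            Nonempty (P ≃ₘ⟮𝓡 4, (𝓡 2).prod (𝓡 2)⟯ (S² × S²))) →
    (∀ (M : Type) [TopologicalSpace M] [T2Space M] [SecondCountableTopology M]
      [ChartedSpace (EuclideanSpace ℝ (Fin 4)) M] [IsManifold (𝓡 4) ∞ M],
      ContinuousMap.HomotopyEquiv M S⁴ →
      (∃ (W : Type) (_ : TopologicalSpace W) (_ : T2Space W) (_ : SecondCountableTopology W)
          (_ : ChartedSpace (EuclideanHalfSpace (4 + 1)) W) (_ : IsManifold (𝓡∂ (4 + 1)) ∞ W)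
          (_ : CompactSpace W),
          ContractibleSpace W ∧
            (∃ f : W → ℝ, IsMorseAdapted (𝓡∂ (4 + 1)) f ∧
              ∀ z, IsMCriticalPt (𝓡∂ (4 + 1)) f z → morseIndex (𝓡∂ (4 + 1)) f z ≤ 2) ∧
            ∃ φ : M → W, Manifold.IsSmoothEmbedding (𝓡 4) (𝓡∂ (4 + 1)) ∞ φ ∧
              Set.range φ = (𝓡∂ (4 + 1)).boundary W) →
      (∃ (P : Type) (_ : TopologicalSpace P) (_ : ChartedSpace (EuclideanSpace ℝ (Fin 4)) P)
          (_ : IsManifold (𝓡 4) ∞ P),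
          IsConnectedSum (𝓡 4) (𝓡 4) ((𝓡 2).prod (𝓡 2)) M (S² × S²) P ∧
            Nonempty (P ≃ₘ⟮𝓡 4, (𝓡 2).prod (𝓡 2)⟯ (S² × S²))) →
      Nonempty (M ≃ₘ⟮𝓡 4, 𝓡 4⟯ S⁴)) →
    Summit.SmoothPoincare4.SmoothPoincare4.Theses.EntropyLadder.PresentationSpheresStandard :=
  presentationSpheresStandard_of_stubs

end Summit.SmoothPoincare4.SmoothPoincare4.Cruxes.PresentationSpheresStandard.Birth
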